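import Summits.Langlands.Langlands.Theses.IwahoriBlockSplit

/-!
# Route IwahoriBlockSplit — Assembly

The assembly item (stmt-Langlands-28115) of the child route `IwahoriBlockSplit` (decomp-langlands lens-2 gen 22; V-R refining child
`--refines route-Langlands-RootDecomp1:SemisimpleMatchingOneDatum`, 85th cell route) for S = `RootDecomp1.SemisimpleMatchingOneDatum` (stmt-Langlands-23600):
`IwahoriBlockMatching → NonIwahoriBlockMatching → RecRigidity → Summit.Langlands.Langlands.Theses.RootDecomp1.SemisimpleMatchingOneDatum`.

This is literally the type of the route file's sorry-free deciding theorem `Summit.Langlands.Langlands.Theses.IwahoriBlockSplit.closes`.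
Nothing here proves `Langlands` (nor the parent piece): the assembly records only that the items of the route, taken together, imply the parent piece
by name.
-/

set_option linter.dupNamespace false -- project-wide option (lakefile weak.linter.dupNamespace); `Summit.Langlands.Langlands` is the mandated namespace

namespace Summit.Langlands.Langlands.Theorems

/-- **Assembly of route IwahoriBlockSplit** (stmt-Langlands-28115):
`IwahoriBlockMatching → NonIwahoriBlockMatching → RecRigidity → Summit.Langlands.Langlands.Theses.RootDecomp1.SemisimpleMatchingOneDatum`.
Proof: unfold `Assembly` and apply the route's deciding theorem `Theses.IwahoriBlockSplit.closes`. -/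
theorem iwahoriBlockSplit_assembly_proof :
    Summit.Langlands.Langlands.Theses.IwahoriBlockSplit.Assembly := by
  unfold Summit.Langlands.Langlands.Theses.IwahoriBlockSplit.Assembly
  exact Summit.Langlands.Langlands.Theses.IwahoriBlockSplit.closes

end Summit.Langlands.Langlands.Theorems
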